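import Literature.AnabelianGeometry.EtaleTheta.Discharge.Sec3Thm37OfInputsOfProp34Const
import Literature.AnabelianGeometry.EtaleTheta.TemperedFrobenioidCnstTorsion
import HarnessLib

/-!
# [EtTh] Theorem 3.7 (i)–(iii), `Λ = ℚ` END KNIT at `D^cnst = 𝓑(G)⁰`, re-keyed onto the named torsion
# predicate `DivisorMonoids.Prop34Cnst₀Torsion` (proof-only)

S. Mochizuki, *The étale theta function …*, Publ. RIMS **45** (2009) [EtTh], Thm. 3.7 PDF pp. 79–80,
Prop. 3.4 (ii) p. 74 [cite: MochizukiEtTh2009, Thm 3.7 p.79].  abc-iut cell, layer L2, node EtTh:Thm3.7 «END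
KNIT», seat abc-iut-w5-d164 (gen 5); sequel of `Sec3Thm37OfInputsOfProp34Const.lean` (p437493).  abc-iut-L2-t3
(gen 4, p440182 `TemperedFrobenioidCnstTorsion.lean`, census item A3) named the raw `Λ = ℚ` binder `hQ` of GAP
row G-w4d084-2 ("automorphisms of `Y` agreeing on `Ker(div₀)` up to torsion have the same image under `cnst`")
as the predicate `DivisorMonoids.Prop34Cnst₀Torsion dm cnst`; this file re-keys the two `Λ = ℚ` knits of
p437493 BY NAME onto it — `thm37_ofRlfQ_of_inputs_of_cosetCnst_of_torsion₀` (residual {`hBmon`, `hD`, `hnd`,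
`hrat`, `h34`, `h₀`, `hT : dm.Prop34Cnst₀Torsion cnst`, `hcyc`}) and
`thm37_ofRlfQ_of_inputs_of_prop34Const_of_torsion₀` (residual {`hBmon`, `hD`, `hnd`, `hrat`, `h34`, `h₀`, `hT`,
`hC : dm.Prop34Const`}) — so that every residual binder of the Thm. 3.7 knits at all three monoid types is a
NAMED predicate on the Def. 3.3 (iii) data, a print hypothesis, or the [FrdI] Thm. 5.2 preamble.
No definitions; nothing here bears on [IUTchIII] Cor. 3.12; typed ≠ proved.
-/

namespace Literature.AnabelianGeometry.EtaleTheta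

open CategoryTheory Opposite Literature.AlgebraicGeometry.Frobenioids Literature.AnabelianGeometry.SemiGraphs

namespace TemperedFrobenioid

universe u₀ v₀ u₁ u v w

variable {D₀ : Type u₀} [Category.{v₀} D₀] {dm : DivisorMonoids.{u₀, v₀, w} D₀}
  {hpf : ∀ Y : D₀ᵒᵖ, IsPerfFactorial (dm.Φ₀.obj Y)} {V : FrdIMonoidStub.{w}} {V₀ : FrdICatStub.{u₀, v₀, w} D₀}
  {D : Type u} [Category.{v} D] {IsRational IsStrictlyRational : (Dᵒᵖ ⥤ CommMonCat.{w}) → Prop}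
  (C₀ : TemperedFrobenioid (RealifiedDivisorMonoids.ofRlfQ dm hpf) D (treeCatVocab D IsRational IsStrictlyRational))
  {GK : Type u₁} [Group GK] [TopologicalSpace GK] [SeparatelyContinuousMul GK] [CompactSpace GK]
  {cnst : D₀ ⥤ CosetCat GK}

/-- **[EtTh] Theorem 3.7 (i)–(iii) for `Λ = ℚ` constructed data with `D^cnst = 𝓑(G)⁰`, binder `hQ` named**
(`hT : dm.Prop34Cnst₀Torsion cnst`, abc-iut-L2-t3 p440182): residual binders
{`hBmon`, `hD`, `hnd`, `hrat`, `h34`, `h₀`, `hT`, `hcyc`}. [cite: MochizukiEtTh2009, Thm 3.7 p.79] -/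
theorem thm37_ofRlfQ_of_inputs_of_cosetCnst_of_torsion₀ (hBmon : IsMonoidOn C₀.ratFnFunctor)
    (hD : IsOfFSMFFType D) (hnd : IsNonDilatingOn C₀.divisorMonoid)
    (hrat : ∀ X : C₀.category,
      PreFrobenioidData.IsRational
        (PreFrobenioid.biratData (C₀.isFrobenioid_treeCatVocab_of_isMonoidOn hBmon)
          (PreFrobenioid.hasBiratSquares_of_isFrobenioid (C₀.isFrobenioid_treeCatVocab_of_isMonoidOn hBmon)))
        (S := PreFrobenioidData.ofFunctor C₀.divisorMonoid C₀.toElem) (fun a 𝔭 => PrimarySupp a 𝔭) X)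
    (h34 : dm.Prop34 V V₀) (h₀ : dm.Prop34Cnst₀ cnst) (hT : dm.Prop34Cnst₀Torsion cnst)
    (hcyc : ∀ Y : D₀ᵒᵖ, ∃ d : dm.Φ₀.obj Y, ∀ b ∈ dm.F₀ Y, ∃ n : ℤ,
      dm.div₀ Y b = Algebra.GrothendieckGroup.of d ^ n) :
    (PreFrobenioid.IsOfIsotropicType C₀.toElem ∧
      PreFrobenioid.IsOfModelType C₀.toElem (C₀.isFrobenioid_treeCatVocab_of_isMonoidOn hBmon)
        (PreFrobenioid.hasBiratSquares_of_isFrobenioid (C₀.isFrobenioid_treeCatVocab_of_isMonoidOn hBmon)) ∧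
      PreFrobenioidData.IsOfBiratFrobeniusNormalizedType
        (PreFrobenioid.biratData (C₀.isFrobenioid_treeCatVocab_of_isMonoidOn hBmon)
          (PreFrobenioid.hasBiratSquares_of_isFrobenioid (C₀.isFrobenioid_treeCatVocab_of_isMonoidOn hBmon))) ∧
      PreFrobenioid.IsOfType (PreFrobenioid.IsSubQuasiFrobeniusTrivial C₀.toElem) ∧
      ¬ PreFrobenioid.IsOfType (PreFrobenioid.IsGroupLikeObj C₀.toElem)) ∧
    ((ModelFrobenioid.data C₀.divisorMonoid C₀.ratFnFunctor C₀.divBNatTrans).IsOfStandardType ∧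
      (PreFrobenioidData.ofFunctor C₀.divisorMonoid C₀.toElem).IsOfRationallyStandardType
        (PreFrobenioid.rsParams (C₀.isFrobenioid_treeCatVocab_of_isMonoidOn hBmon) fun a 𝔭 => PrimarySupp a 𝔭)) ∧
    ((∀ A : C₀.category,
        FrobenioidFacade.AutActionFactorsThrough (C₀.base ⋙ cnst) C₀.toElem A) ∧
      (∀ A : C₀.category, FrobenioidFacade.AutActionFaithful (C₀.base ⋙ cnst) C₀.toElem A)) :=
  C₀.thm37_ofRlfQ_of_inputs_of_cosetCnst hBmon hD hnd hrat h34 h₀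
    (fun g g' hb => hT.cnst_map_eq_of_B₀_map_pow_eq g g' hb) hcyc

/-- **The same, knit onto `DivisorMonoids.Prop34Const`** (`hcyc := Prop34Const.hcyc hC`): residual binders
{`hBmon`, `hD`, `hnd`, `hrat`, `h34`, `h₀`, `hT`, `hC : dm.Prop34Const`} — all NAMED predicates.
[cite: MochizukiEtTh2009, Thm 3.7 p.79] -/
theorem thm37_ofRlfQ_of_inputs_of_prop34Const_of_torsion₀ (hBmon : IsMonoidOn C₀.ratFnFunctor)
    (hD : IsOfFSMFFType D) (hnd : IsNonDilatingOn C₀.divisorMonoid)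
    (hrat : ∀ X : C₀.category,
      PreFrobenioidData.IsRational
        (PreFrobenioid.biratData (C₀.isFrobenioid_treeCatVocab_of_isMonoidOn hBmon)
          (PreFrobenioid.hasBiratSquares_of_isFrobenioid (C₀.isFrobenioid_treeCatVocab_of_isMonoidOn hBmon)))
        (S := PreFrobenioidData.ofFunctor C₀.divisorMonoid C₀.toElem) (fun a 𝔭 => PrimarySupp a 𝔭) X)
    (h34 : dm.Prop34 V V₀) (h₀ : dm.Prop34Cnst₀ cnst) (hT : dm.Prop34Cnst₀Torsion cnst) (hC : dm.Prop34Const) :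
    (PreFrobenioid.IsOfIsotropicType C₀.toElem ∧
      PreFrobenioid.IsOfModelType C₀.toElem (C₀.isFrobenioid_treeCatVocab_of_isMonoidOn hBmon)
        (PreFrobenioid.hasBiratSquares_of_isFrobenioid (C₀.isFrobenioid_treeCatVocab_of_isMonoidOn hBmon)) ∧
      PreFrobenioidData.IsOfBiratFrobeniusNormalizedType
        (PreFrobenioid.biratData (C₀.isFrobenioid_treeCatVocab_of_isMonoidOn hBmon)
          (PreFrobenioid.hasBiratSquares_of_isFrobenioid (C₀.isFrobenioid_treeCatVocab_of_isMonoidOn hBmon))) ∧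
      PreFrobenioid.IsOfType (PreFrobenioid.IsSubQuasiFrobeniusTrivial C₀.toElem) ∧
      ¬ PreFrobenioid.IsOfType (PreFrobenioid.IsGroupLikeObj C₀.toElem)) ∧
    ((ModelFrobenioid.data C₀.divisorMonoid C₀.ratFnFunctor C₀.divBNatTrans).IsOfStandardType ∧
      (PreFrobenioidData.ofFunctor C₀.divisorMonoid C₀.toElem).IsOfRationallyStandardType
        (PreFrobenioid.rsParams (C₀.isFrobenioid_treeCatVocab_of_isMonoidOn hBmon) fun a 𝔭 => PrimarySupp a 𝔭)) ∧
    ((∀ A : C₀.category,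
        FrobenioidFacade.AutActionFactorsThrough (C₀.base ⋙ cnst) C₀.toElem A) ∧
      (∀ A : C₀.category, FrobenioidFacade.AutActionFaithful (C₀.base ⋙ cnst) C₀.toElem A)) :=
  C₀.thm37_ofRlfQ_of_inputs_of_cosetCnst_of_torsion₀ hBmon hD hnd hrat h34 h₀ hT hC.hcyc

end TemperedFrobenioid

end Literature.AnabelianGeometry.EtaleTheta
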